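import Summits.Ventures.HodgeKum4.Theorems.KummerFixedLocusL1HilbUnitEngine
import Summits.Ventures.HodgeKum4.Theorems.KummerFixedLocusL1HilbSeam
import Literature.AlgebraicGeometry.Hyperkaehler.TotalCohomologyCross
import HarnessLib

/-!
# Lane (V), line v2p5 — stub S-F (`stub_span`), JOIN half, J1: `SF.unitReach` (the all-unit monomials are reached)

Cell `hodge-kum4`, crux stmt-Ventures-20306 (`LefschetzGenerationHilb5`, W-form), seam `SF.JoinHalf`
(`Theorems/KummerFixedLocusL1HilbSeam`, plan g19): `JoinHalf ⇐ J1 UnitReach + J2 PolarReach` (plan scratch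
`SeamSF.v2.PLAN` e3a3fc3607265de7, composition `joinHalf_of_plan` kernel-checked there; J2 = p2 g12's `SF.polarReach`).
THIS FILE (p5 g1) = J1, PART C over plan g19's parts A/B (`KummerFixedLocusL1HilbUnitWords` ∕ `…UnitEngine`):

* `SF.unitReach` — **J1 `UnitReach` VERBATIM** (binder list of the plan's `def UnitReach`): for Chern character operators
  `𝔊`, a homogeneous basis `b` of `H*(S)` with `b i₀ = 1_S`, and a subspace `W ⊆ ℍₙ = H*(S^[n])` containing `1_{S^[n]}`,
  stable under cup product with `G₁(1_S, n)` (Lehn's `𝔡|ₙ`) and SHAPE-GRADED in the Nakajima monomial basis, every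
  all-unit monomial `Π_r 𝔮_r(1_S)^{s_r}|0⟩` (indices supported on the colour of `i₀`) lies in `W`.

Proof (V2-MECHANISM §6 ∕ plan): induction on `n − #parts` over unit WORDS `l` (parts `≥ 1`, sum `n`):
`#parts = n` forces `l = 1ⁿ` and `𝔮₁(1)ⁿ|0⟩ = n!·1_{S^[n]}` (`NakajimaOperators.unit_pow`); otherwise pick a part `r ≥ 2`,
split it as `1 + (r−1)`: the longer word `l' = 1 :: (r−1) :: l₀` is in `W` by induction, `𝔡` of it is in `W`
(`h𝔡`, `cupOperator_apply_ofSummand`), and its isotypic piece of the shape of `r :: l₀` (in `W` by shape-gradedness)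
is a NON-ZERO multiple of the monomial of `r :: l₀ ~ l`: the coordinate on that index is `−((r−1) + m)`, `m ∈ ℕ`
(`Unit.coord_apply_uWord_target`, Lehn's rule `[[𝔡,𝔮ₐ(1)],𝔮_b(1)] = −ab·𝔮_{a+b}(1)` = `ChernCharacterOperators.boundary_bracket`),
and every other index of that shape is not unit-coloured, so gets `0` (`Unit.coord_apply_uWord_offColour`: junk terms
have more letters — p2's `admSpanGe` — and join terms are unit words).

Kernel-only, standard axioms, 0 named facts.  HONEST FRAMING: a helper (one of the two inputs of `SF.JoinHalf`);
nothing here asserts S-F ∕ L1-Hilb(5) ∕ L1 ∕ HC_Kum4Type ∕ HC.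
-/

noncomputable section

open DirectSum
open Literature.AlgebraicTopology.SingularHomology
open Literature.AlgebraicGeometry Literature.AlgebraicGeometry.Hyperkaehler Literature.AlgebraicGeometry.HilbertScheme
open Literature.AlgebraicGeometry.Motives (ComplexPoints SchemeOver IsSmoothProjective)

namespace Summit.Ventures.HodgeKum4.L1Hilb.SF

open Summit.Ventures.HodgeKum4.L1Hilb Summit.Ventures.HodgeKum4.L1Hilb.Join Summit.Ventures.HodgeKum4.L1Hilb.Unit

universe u v w

/-! ### C0. List and index bookkeeping -/

/-- A list of positive naturals whose sum is its length consists of ones. -/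
theorem list_eq_replicate_one_of_sum_eq_length {l : List ℕ} (hl : ∀ a ∈ l, 1 ≤ a) (hs : l.sum = l.length) :
    l = List.replicate l.length 1 := by
  induction l with
  | nil => rfl
  | cons a l ih =>
    have ha : 1 ≤ a := hl a List.mem_cons_self
    have hl' : ∀ b ∈ l, 1 ≤ b := fun b hb ↦ hl b (List.mem_cons_of_mem a hb)
    have hlen : l.length ≤ l.sum := List.length_le_sum_of_one_le l hl'
    rw [List.sum_cons, List.length_cons] at hs
    have ha1 : a = 1 := by omega
    have hs' : l.sum = l.length := by omega
    rw [List.length_cons, List.replicate_succ, ← ih hl' hs', ha1]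

/-- A list of positive naturals whose sum exceeds its length has an entry `≥ 2`. -/
theorem exists_two_le_of_length_lt_sum {l : List ℕ} (hs : l.length < l.sum) : ∃ a ∈ l, 2 ≤ a := by
  by_contra h
  simp only [not_exists, not_and, not_le] at h
  have := List.sum_le_card_nsmul l 1 fun a ha ↦ by have := h a ha; omega
  rw [smul_eq_mul, mul_one] at this
  omega

section Indices

variable {N n : ℕ}

/-- The number of parts is the total of the shape. -/
theorem numParts_eq_sum_shapeOf (ρ : Fin N → Fin (n + 1) → ℕ) : numParts ρ = ∑ r, shapeOf ρ r := by
  rw [numParts, Finset.sum_comm]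
  rfl

/-- A unit-coloured index is determined by its shape: `ρ c₀ r = shapeOf ρ r`. -/
theorem apply_eq_shapeOf_of_unitColoured {ρ : Fin N → Fin (n + 1) → ℕ} {c₀ : Fin N}
    (hρ : ∀ c, c ≠ c₀ → ∀ r, ρ c r = 0) (r : Fin (n + 1)) : ρ c₀ r = shapeOf ρ r := by
  rw [shapeOf, Finset.sum_eq_single c₀ (fun c _ hc ↦ hρ c hc r) (fun h ↦ (h (Finset.mem_univ _)).elim)]

/-- Two unit-coloured indices (same colour) with the same shape are equal. -/
theorem eq_of_unitColoured_of_shapeOf_eq {ρ ρ' : Fin N → Fin (n + 1) → ℕ} {c₀ : Fin N}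
    (hρ : ∀ c, c ≠ c₀ → ∀ r, ρ c r = 0) (hρ' : ∀ c, c ≠ c₀ → ∀ r, ρ' c r = 0) (hs : shapeOf ρ = shapeOf ρ') :
    ρ = ρ' := by
  funext c r
  by_cases hc : c = c₀
  · subst hc
    rw [apply_eq_shapeOf_of_unitColoured hρ, apply_eq_shapeOf_of_unitColoured hρ', hs]
  · rw [hρ c hc r, hρ' c hc r]

end Indices

/-! ### C1. The `ℍₙ`-component of a unit word vector, with its number of parts -/

section Words

variable {K : Type u} [Field K]
variable {A : ℕ → Type v} [∀ i, AddCommGroup (A i)] [∀ i, Module K (A i)]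
variable {Φ : ℕ → ℕ → Type w} [∀ n i, AddCommGroup (Φ n i)] [∀ n i, Module K (Φ n i)]
variable {B : (⨁ i, A i) →ₗ[K] (⨁ i, A i) →ₗ[K] K} {q : ℤ → (⨁ i, A i) →ₗ[K] Module.End K (Fock Φ)} {vac : Fock Φ}
variable {N : ℕ} {x : Fin N → ⨁ i, A i} {deg : Fin N → ℕ}

/-- `Unit.component_unitWord_vac` with the part count recorded: the `ℍₙ`-component of `U_l|0⟩` (parts `≥ 1`, unit
colour `c₀`) is `0` or a basis vector `Bn ρ` with `ρ` unit-coloured AND `numParts ρ = |l|`. -/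
theorem component_unitWord_vac_numParts (h : IsHeisenbergRepresentation B q vac) {n : ℕ}
    (Bn : Module.Basis {ρ : Fin N → Fin (n + 1) → ℕ // IsPartitionValued deg n ρ} K (FockSummand Φ n))
    (hBn : ∀ ρ, Fock.ofSummand K Φ n (Bn ρ) = heisenbergMonomial q vac x n ρ.1)
    {c₀ : Fin N} (hc₀ : deg c₀ = 0) (hx₀ : x c₀ ∈ LinearMap.range (lof K ℕ A 0))
    (l : List ℕ) (hl : ∀ b ∈ l, 1 ≤ b) :
    DirectSum.component K ℕ (fun p ↦ FockSummand Φ p) n (monomialOp q (unitWord (x c₀) l) vac) = 0 ∨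
      ∃ ρ : {ρ : Fin N → Fin (n + 1) → ℕ // IsPartitionValued deg n ρ}, (∀ c, c ≠ c₀ → ∀ r, ρ.1 c r = 0) ∧
        numParts ρ.1 = l.length ∧
        DirectSum.component K ℕ (fun p ↦ FockSummand Φ p) n (monomialOp q (unitWord (x c₀) l) vac) = Bn ρ := by
  classical
  set ls := l.insertionSort (· ≤ ·) with hls
  have hperm : ls.Perm l := List.perm_insertionSort _ _
  have hsorted : ls.Pairwise (· ≤ ·) := List.pairwise_insertionSort _ _
  have hls1 : ∀ b ∈ ls, 1 ≤ b := fun b hb ↦ hl b (hperm.mem_iff.1 hb)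
  have hU : monomialOp q (unitWord (x c₀) l) = monomialOp q (unitWord (x c₀) ls) :=
    monomialOp_unitWord_perm h hx₀ hperm.symm hl
  rw [hU, ← letterWord_unitLetters]
  have hadm : IsAdmissibleWord deg (unitLetters c₀ ls) :=
    isAdmissibleWord_unitLetters (by rw [hc₀]; exact ⟨0, rfl⟩) hls1 hsorted
  obtain ⟨z, hz⟩ := h.monomialOp_vac_mem_range (letterWord x (unitLetters c₀ ls))
  by_cases hn : wordMode (letterWord x (unitLetters c₀ ls)) = n
  · right
    have hpv : IsPartitionValued deg n (countFn n (unitLetters c₀ ls)) := isPartitionValued_countFn x hadm hn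
    refine ⟨⟨countFn n (unitLetters c₀ ls), hpv⟩, fun c hc r ↦ countFn_unitLetters_of_ne n c₀ ls hc r, ?_, ?_⟩
    · have hparts : ∀ σ ∈ unitLetters c₀ ls, letterPart σ ≤ n := fun σ hσ ↦ hn ▸ letterPart_le_wordMode x hσ
      rw [numParts_countFn hadm.pairwise_le hparts, length_unitLetters, hperm.length_eq]
    · have hb := hBn ⟨countFn n (unitLetters c₀ ls), hpv⟩
      rw [heisenbergMonomial_countFn q vac x hadm hn] at hb
      rw [← hb, DirectSum.component.lof_self]
  · left
    rw [← hz, DirectSum.component.of, dif_neg hn]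

end Words

/-! ### C2. The cell: Lehn's boundary operator on the tree's carriers -/

variable {S : SchemeOver ℂ} {hS : IsSmoothProjective 2 S} {H : HilbertSchemesOfPoints S}

/-- **Lehn's rule as an operator identity**: `[[𝔡, 𝔮ₐ(1_S)], 𝔮_b(1_S)] y = −(a·b) • 𝔮_{a+b}(1_S) y` for `a, b > 0`
(`ChernCharacterOperators.boundary_bracket` with `α = β = 1_S`, parities `0`, `1_S ∪ 1_S = 1_S`). -/
theorem boundary_hE (𝔊 : ChernCharacterOperators hS H) (a b : ℕ) (ha : 0 < a) (hb : 0 < b) (y : fockSpace H) :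
    (𝔊.boundaryOperator * 𝔊.q a (unitCoeff S) - 𝔊.q a (unitCoeff S) * 𝔊.boundaryOperator)
        (𝔊.q b (unitCoeff S) y) -
      𝔊.q b (unitCoeff S)
        ((𝔊.boundaryOperator * 𝔊.q a (unitCoeff S) - 𝔊.q a (unitCoeff S) * 𝔊.boundaryOperator) y) =
      -(((a : ℂ) * b) • 𝔊.q ((a + b : ℕ) : ℤ) (unitCoeff S) y) := by
  have hab : (a : ℤ) + b ≠ 0 := by omega
  have hu : ofDegree ℂ (ComplexPoints S) 0 (singularCohomology.one ℂ (ComplexPoints S)) = unitCoeff S := rfl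
  have key := 𝔊.boundary_bracket a b hab 0 (singularCohomology.one ℂ (ComplexPoints S)) 0
    (singularCohomology.one ℂ (ComplexPoints S))
  rw [superBracket_of_even_left _ _ ⟨0, rfl⟩, superBracket_of_even_left _ _ ⟨0, rfl⟩, totalCup_one, hu] at key
  have key' := congrArg (fun T : Module.End ℂ (fockSpace H) ↦ T y) key
  simp only [LinearMap.sub_apply, Module.End.mul_apply, LinearMap.smul_apply, map_sub] at key'
  simp only [ChernCharacterOperators.boundaryOperator, ChernCharacterOperators.cupOperator, LinearMap.sub_apply,
    Module.End.mul_apply, map_sub]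
  push_cast at key' ⊢
  rw [key', neg_smul]

/-- `𝔡` kills the vacuum. -/
theorem boundary_vac (𝔊 : ChernCharacterOperators hS H) : 𝔊.boundaryOperator (vacuumVector H) = 0 :=
  𝔊.cupOperator_vacuum 1 _

/-- The `ℍₙ`-block of `𝔡` is cup product with `G₁(1_S, n)`. -/
theorem component_boundary_ofSummand (𝔊 : ChernCharacterOperators hS H) (n : ℕ)
    (w : totalCohomology ℂ (ComplexPoints (H.obj n))) :
    DirectSum.component ℂ ℕ (fun p ↦ FockSummand (fockFamily H) p) n
        (𝔊.boundaryOperator (Fock.ofSummand ℂ (fockFamily H) n w)) =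
      totalCup ℂ (ComplexPoints (H.obj n)) (𝔊.G 1 n (unitCoeff S)) w := by
  rw [ChernCharacterOperators.boundaryOperator, 𝔊.cupOperator_apply_ofSummand, DirectSum.component.lof_self]

/-- `𝔡(𝔮ₐ(1_S)|0⟩) ∈ ℍₐ ⊆ admSpanGe 1` for `a ≥ 1` (junk has at least one letter). -/
theorem boundary_q_vac_mem_admSpanGe_one (𝔊 : ChernCharacterOperators hS H) {N : ℕ}
    {x : Fin N → totalCohomology ℂ (ComplexPoints S)} {deg : Fin N → ℕ}
    (hx : ∀ c, x c ∈ LinearMap.range (ofDegree ℂ (ComplexPoints S) (deg c)))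
    (hsp : Submodule.span ℂ (Set.range x) = ⊤) (a : ℕ) (ha : 1 ≤ a) :
    𝔊.boundaryOperator (𝔊.q (a : ℤ) (unitCoeff S) (vacuumVector H)) ∈
      admSpanGe 𝔊.q x (vacuumVector H) deg 1 := by
  have hmem : 𝔊.q (a : ℤ) (unitCoeff S) (vacuumVector H) ∈
      LinearMap.range (Fock.ofSummand ℂ (fockFamily H) a) := by
    have := 𝔊.isHeisenberg.monomialOp_vac_mem_range [(a, unitCoeff S)]
    rwa [monomialOp_cons, monomialOp_nil, mul_one, wordMode_cons, wordMode_nil, Nat.add_zero] at this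
  obtain ⟨z, hz⟩ := hmem
  refine range_ofSummand_le_admSpanGe_one 𝔊.isHeisenberg two_ne_zero hx hsp ha
    ⟨totalCup ℂ (ComplexPoints (H.obj a)) (𝔊.G 1 a (unitCoeff S)) z, ?_⟩
  rw [← hz, ChernCharacterOperators.boundaryOperator, 𝔊.cupOperator_apply_ofSummand]

/-- A homogeneous basis vector equal to `1_S` has degree `0`. -/
theorem deg_eq_zero_of_eq_unitCoeff {ι : Type} (b : Module.Basis ι ℂ (totalCohomology ℂ (ComplexPoints S))) (i₀ : ι)
    (hb0 : b i₀ = unitCoeff S) (deg : ι → ℕ)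
    (hb : ∀ i, b i ∈ LinearMap.range (ofDegree ℂ (ComplexPoints S) (deg i))) : deg i₀ = 0 := by
  classical
  by_contra hd
  obtain ⟨y, hy⟩ := hb i₀
  have hne : b i₀ ≠ 0 := b.ne_zero i₀
  have h0 := congrArg (DirectSum.component ℂ ℕ (fun k ↦ singularCohomology ℂ ℂ (ComplexPoints S) k) 0) hy
  rw [hb0, unitCoeff, DirectSum.component.of, dif_neg hd, DirectSum.component.lof_self] at h0
  apply hne
  rw [hb0, unitCoeff, ← h0, map_zero]

/-! ### C3. The induction over unit words -/

/-- **J1 on words**: under the hypotheses of `UnitReach`, the `ℍₙ`-component of every unit word vector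
`𝔮_{a₁}(1_S)⋯𝔮_{a_k}(1_S)|0⟩` (parts `aⱼ ≥ 1`, `Σ aⱼ = n`) lies in `W`. -/
theorem component_unitWord_mem (𝔊 : ChernCharacterOperators hS H)
    {ι : Type} [Fintype ι] [DecidableEq ι] (b : Module.Basis ι ℂ (totalCohomology ℂ (ComplexPoints S))) (i₀ : ι)
    (hb0 : b i₀ = unitCoeff S)
    (deg : ι → ℕ) (hb : ∀ i, b i ∈ LinearMap.range (ofDegree ℂ (ComplexPoints S) (deg i)))
    (n : ℕ) (W : Submodule ℂ (totalCohomology ℂ (ComplexPoints (H.obj n))))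
    (h1 : ofDegree ℂ (ComplexPoints (H.obj n)) 0 (singularCohomology.one ℂ (ComplexPoints (H.obj n))) ∈ W)
    (h𝔡 : ∀ w ∈ W, totalCup ℂ (ComplexPoints (H.obj n)) (𝔊.G 1 n (unitCoeff S)) w ∈ W)
    (hSG : ShapeGraded (monBasis 𝔊.toNakajimaOperators b deg hb n) (fun ρ ↦ shapeOf ρ.1) W)
    (l : List ℕ) (hl : ∀ a ∈ l, 1 ≤ a) (hsum : l.sum = n) :
    DirectSum.component ℂ ℕ (fun p ↦ FockSummand (fockFamily H) p) n
      (monomialOp 𝔊.q (unitWord (unitCoeff S) l) (vacuumVector H)) ∈ W := by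
  classical
  -- notation and the standing hypotheses of the generic lemmas
  set 𝔑 := 𝔊.toNakajimaOperators with h𝔑
  set e := Fintype.equivFin ι with he
  set x : Fin (Fintype.card ι) → totalCohomology ℂ (ComplexPoints S) := ⇑b ∘ e.symm with hxdef
  set c₀ : Fin (Fintype.card ι) := e i₀ with hc₀def
  set Bn := monBasis 𝔑 b deg hb n with hBndef
  have hh : IsHeisenbergRepresentation (A := coeffFamily S) (Φ := fockFamily H) (poincarePairing hS) 𝔑.q
      (vacuumVector H) := 𝔑.isHeisenberg
  have hxc₀ : x c₀ = unitCoeff S := by simp [hxdef, hc₀def, hb0]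
  have hx : ∀ c, x c ∈ LinearMap.range (ofDegree ℂ (ComplexPoints S) ((deg ∘ e.symm) c)) := fun c ↦ hb _
  have hsp : Submodule.span ℂ (Set.range x) = ⊤ := by
    rw [hxdef, Set.range_comp, e.symm.surjective.range_eq, Set.image_univ, b.span_eq]
  have hdeg0 : (deg ∘ e.symm) c₀ = 0 := by
    simp only [Function.comp_apply, hc₀def, Equiv.symm_apply_apply]
    exact deg_eq_zero_of_eq_unitCoeff b i₀ hb0 deg hb
  have hx₀ : x c₀ ∈ LinearMap.range (lof ℂ ℕ (coeffFamily S) 0) := ⟨_, hxc₀.symm⟩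
  have hBn : ∀ ρ, Fock.ofSummand ℂ (fockFamily H) n (Bn ρ) = heisenbergMonomial 𝔑.q (vacuumVector H) x n ρ.1 :=
    fun ρ ↦ by rw [hBndef, monBasis, NakajimaOperators.heisenbergMonomialBasisSummand_apply]
  have hD1 : ∀ a : ℕ, 1 ≤ a → 𝔊.boundaryOperator (𝔑.q (a : ℤ) (x c₀) (vacuumVector H)) ∈
      admSpanGe 𝔑.q x (vacuumVector H) (deg ∘ e.symm) 1 := fun a ha ↦ by
    rw [hxc₀]; exact boundary_q_vac_mem_admSpanGe_one 𝔊 hx hsp a ha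
  have hE : ∀ a b' : ℕ, 0 < a → 0 < b' → ∀ y : fockSpace H,
      (𝔊.boundaryOperator * 𝔑.q a (x c₀) - 𝔑.q a (x c₀) * 𝔊.boundaryOperator) (𝔑.q b' (x c₀) y) -
        𝔑.q b' (x c₀) ((𝔊.boundaryOperator * 𝔑.q a (x c₀) - 𝔑.q a (x c₀) * 𝔊.boundaryOperator) y) =
        -(((a : ℂ) * b') • 𝔑.q ((a + b' : ℕ) : ℤ) (x c₀) y) := fun a b' ha hb' y ↦ by
    rw [hxc₀]; exact boundary_hE 𝔊 a b' ha hb' y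
  -- induction on `n − |l|`
  rw [← hxc₀]
  suffices main : ∀ k (l : List ℕ), (∀ a ∈ l, 1 ≤ a) → l.sum = n → n - l.length = k →
      DirectSum.component ℂ ℕ (fun p ↦ FockSummand (fockFamily H) p) n
        (monomialOp 𝔑.q (unitWord (x c₀) l) (vacuumVector H)) ∈ W from main _ l hl hsum rfl
  intro k
  induction k with
  | zero =>
    intro l hl hsum hk
    -- all parts are `1`: `𝔮₁(1)ⁿ|0⟩ = n! · 1_{S^[n]}`
    have hlen : l.length ≤ l.sum := List.length_le_sum_of_one_le l hl
    have hl1 : l = List.replicate n 1 := by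
      rw [list_eq_replicate_one_of_sum_eq_length hl (by omega)]
      congr 1; omega
    rw [hl1, monomialOp_unitWord_replicate, hxc₀, Nat.cast_one, 𝔑.unit_pow n, map_smul]
    refine Submodule.smul_mem _ _ ?_
    rw [unitVector, Fock.of, LinearMap.comp_apply, DirectSum.component.lof_self]
    exact h1
  | succ k ih =>
    intro l hl hsum hk
    -- a part `r ≥ 2`, split as `1 + (r - 1)`
    have hlen : l.length < l.sum := by omega
    obtain ⟨r, hr, hr2⟩ := exists_two_le_of_length_lt_sum hlen
    set l₀ := l.erase r with hl₀def
    have hperm : l.Perm (r :: l₀) := List.perm_cons_erase hr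
    have hl₀ : ∀ a ∈ l₀, 1 ≤ a := fun a ha ↦ hl a (List.mem_of_mem_erase ha)
    have hrl₀ : ∀ a ∈ r :: l₀, 1 ≤ a := fun a ha ↦ hl a (hperm.symm.mem_iff.1 ha)
    -- the longer word
    set l' := 1 :: (r - 1) :: l₀ with hl'def
    have hl' : ∀ a ∈ l', 1 ≤ a := by
      intro a ha
      rcases List.mem_cons.1 ha with rfl | ha
      · exact le_rfl
      rcases List.mem_cons.1 ha with rfl | ha
      · omega
      · exact hl₀ a ha
    have hsum' : l'.sum = n := by
      rw [hl'def, List.sum_cons, List.sum_cons, ← hsum, hperm.sum_eq, List.sum_cons]; omega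
    have hlenl : l.length = l₀.length + 1 := by rw [hperm.length_eq, List.length_cons]
    have hlen' : n - l'.length = k := by
      simp only [hl'def, List.length_cons]
      omega
    have ih' := ih l' hl' hsum' hlen'
    -- `v' = U_{l'}|0⟩ ∈ ℍₙ`, `w'` its component, `𝔡 v'` has component `G₁(1,n) ∪ w' ∈ W`
    set v' := monomialOp 𝔑.q (unitWord (x c₀) l') (vacuumVector H) with hv'def
    have hv'mem : v' ∈ LinearMap.range (Fock.ofSummand ℂ (fockFamily H) n) := by
      have := hh.monomialOp_vac_mem_range (unitWord (x c₀) l')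
      rwa [wordMode_unitWord, hsum'] at this
    obtain ⟨w', hw'⟩ := hv'mem
    have hw'eq : DirectSum.component ℂ ℕ (fun p ↦ FockSummand (fockFamily H) p) n v' = w' := by
      rw [← hw', DirectSum.component.lof_self]
    set u := DirectSum.component ℂ ℕ (fun p ↦ FockSummand (fockFamily H) p) n (𝔊.boundaryOperator v') with hudef
    have hu : u ∈ W := by
      rw [hudef, ← hw', component_boundary_ofSummand]
      exact h𝔡 w' (hw'eq ▸ ih')
    -- the target word `r :: l₀ ~ l`
    rw [monomialOp_unitWord_perm hh hx₀ hperm hl]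
    rcases component_unitWord_vac_numParts hh Bn hBn hdeg0 hx₀ (r :: l₀) hrl₀ with h0 | ⟨ρ, hρ, hρparts, hρeq⟩
    · rw [h0]; exact W.zero_mem
    rw [hρeq]
    -- `U_{r :: l₀}|0⟩ = Bn ρ` read in `ℍ`
    have hρ' : Fock.ofSummand ℂ (fockFamily H) n (Bn ρ) =
        monomialOp 𝔑.q (uWord (x c₀) ((1 + (r - 1)) :: l₀)) (vacuumVector H) := by
      rw [show 1 + (r - 1) = r by omega, ← unitWord_eq_uWord, ← hρeq]
      have := hh.monomialOp_vac_mem_range (unitWord (x c₀) (r :: l₀))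
      rw [wordMode_unitWord, ← hperm.sum_eq, hsum] at this
      obtain ⟨z, hz⟩ := this
      rw [← hz, DirectSum.component.lof_self]
    rw [List.length_cons] at hρparts
    -- the coordinate of `u` on `ρ` is `−((r−1) + m) ≠ 0`
    obtain ⟨m, hm⟩ := coord_apply_uWord_target hh two_ne_zero hx hsp Bn hBn hdeg0 hx₀ 𝔊.boundaryOperator
      (boundary_vac 𝔊) hE hD1 (s := 1) (t := r - 1) le_rfl (by omega) l₀ hl₀ ρ hρ' hρparts
    have hmu : Bn.repr u ρ = -((1 * (r - 1) + m : ℕ) : ℂ) := by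
      rw [← Module.Basis.coord_apply, hudef, hv'def, hl'def, unitWord_eq_uWord]; exact hm
    have hne : Bn.repr u ρ ≠ 0 := by
      rw [hmu, neg_ne_zero, Nat.cast_ne_zero]; omega
    -- every OTHER index of the same shape is not unit-coloured, hence has coordinate `0`
    have hoff : ∀ ρ'' ∈ (Bn.repr u).support, shapeOf ρ''.1 = shapeOf ρ.1 → ρ'' ≠ ρ → Bn.repr u ρ'' • Bn ρ'' = 0 := by
      intro ρ'' _ hshape hne''
      have hnc : ∃ c, c ≠ c₀ ∧ ∃ r', ρ''.1 c r' ≠ 0 := by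
        by_contra hcon
        simp only [not_exists, not_and, not_not] at hcon
        exact hne'' (Subtype.ext (eq_of_unitColoured_of_shapeOf_eq (fun c hc r' ↦ hcon c hc r') hρ hshape))
      have hparts'' : numParts ρ''.1 < l'.length := by
        rw [numParts_eq_sum_shapeOf, hshape, ← numParts_eq_sum_shapeOf, hρparts, hl'def, List.length_cons,
          List.length_cons]
        omega
      have h0 := coord_apply_uWord_offColour hh two_ne_zero hx hsp Bn hBn hdeg0 hx₀ 𝔊.boundaryOperator
        (boundary_vac 𝔊) hE hD1 l' hl' ρ'' hparts'' hnc
      rw [Module.Basis.coord_apply, ← unitWord_eq_uWord, ← hv'def, ← hudef] at h0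
      rw [h0, zero_smul]
    -- the shape piece of `u` is `(Bn.repr u ρ) • Bn ρ ∈ W`
    have hpiece := hSG u hu (shapeOf ρ.1)
    rw [Finset.sum_eq_single ρ (fun ρ'' hρ'' hne'' ↦ hoff ρ'' (Finset.mem_filter.1 hρ'').1
      (Finset.mem_filter.1 hρ'').2 hne'') (fun hnot ↦ by
        rw [Finset.mem_filter, not_and] at hnot
        by_cases hsupp : ρ ∈ (Bn.repr u).support
        · exact (hnot hsupp rfl).elim
        · rw [Finsupp.notMem_support_iff.1 hsupp, zero_smul])] at hpiece
    have := W.smul_mem (Bn.repr u ρ)⁻¹ hpiece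
    rwa [smul_smul, inv_mul_cancel₀ hne, one_smul] at this

/-- **J1 `UnitReach`** (plan g19 `SeamSF.v2.PLAN` e3a3fc3607265de7, VERBATIM binder list): the all-unit monomials
(indices supported on the colour of `i₀`, `b i₀ = 1_S`) of every shape lie in a shape-graded `W ∋ 1_{S^[n]}` stable
under cup with `G₁(1_S, n)`. -/
theorem unitReach ⦃S : SchemeOver ℂ⦄ ⦃hS : IsSmoothProjective 2 S⦄ ⦃H : HilbertSchemesOfPoints S⦄
    (𝔊 : ChernCharacterOperators hS H)
    {ι : Type} [Fintype ι] [DecidableEq ι] (b : Module.Basis ι ℂ (totalCohomology ℂ (ComplexPoints S))) (i₀ : ι)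
    (hb0 : b i₀ = unitCoeff S)
    (deg : ι → ℕ) (hb : ∀ i, b i ∈ LinearMap.range (ofDegree ℂ (ComplexPoints S) (deg i)))
    (n : ℕ) (W : Submodule ℂ (totalCohomology ℂ (ComplexPoints (H.obj n))))
    (h1 : ofDegree ℂ (ComplexPoints (H.obj n)) 0 (singularCohomology.one ℂ (ComplexPoints (H.obj n))) ∈ W)
    (h𝔡 : ∀ w ∈ W, totalCup ℂ (ComplexPoints (H.obj n)) (𝔊.G 1 n (unitCoeff S)) w ∈ W)
    (hSG : ShapeGraded (monBasis 𝔊.toNakajimaOperators b deg hb n) (fun ρ ↦ shapeOf ρ.1) W)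
    (ρ : {ρ : Fin (Fintype.card ι) → Fin (n + 1) → ℕ // IsPartitionValued (deg ∘ (Fintype.equivFin ι).symm) n ρ})
    (hρ : ∀ c, c ≠ Fintype.equivFin ι i₀ → ∀ r, ρ.1 c r = 0) :
    monBasis 𝔊.toNakajimaOperators b deg hb n ρ ∈ W := by
  classical
  have hxc₀ : (⇑b ∘ (Fintype.equivFin ι).symm) (Fintype.equivFin ι i₀) = unitCoeff S := by simp [hb0]
  -- the basis vector is the unit word of `partsList ρ`, read in `ℍₙ`
  have happly : Fock.ofSummand ℂ (fockFamily H) n (monBasis 𝔊.toNakajimaOperators b deg hb n ρ) =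
      monomialOp 𝔊.q (unitWord (unitCoeff S) (partsList n ρ.1 (Fintype.equivFin ι i₀))) (vacuumVector H) := by
    rw [monBasis, NakajimaOperators.heisenbergMonomialBasisSummand_apply, heisenbergMonomial,
      pvWord_eq_unitWord n ρ.1 (Fintype.equivFin ι i₀) hρ, hxc₀]
  have hparts : ∀ a ∈ partsList n ρ.1 (Fintype.equivFin ι i₀), 1 ≤ a := fun a ha ↦ one_le_of_mem_partsList ρ.2 ha
  have hsum : (partsList n ρ.1 (Fintype.equivFin ι i₀)).sum = n := by
    have h := wordMode_pvWord (⇑b ∘ (Fintype.equivFin ι).symm) n ρ.1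
    rw [pvWord_eq_unitWord n ρ.1 (Fintype.equivFin ι i₀) hρ, wordMode_unitWord, ρ.2.2.2] at h
    exact h
  have key := component_unitWord_mem 𝔊 b i₀ hb0 deg hb n W h1 h𝔡 hSG _ hparts hsum
  rwa [← happly, DirectSum.component.lof_self] at key

end Summit.Ventures.HodgeKum4.L1Hilb.SF

end
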